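/-
Origin: expansion seat `planner-pub-hodgecm-pohl-g13-0`, handover #9 2026-08-18T14:29:10Z (md5 ed1a2ecb948036148b2e6824157471c0, 316 l.; RUN 31 additive leaf; lands AFTER my #7 GaloisSpanGeneric (c949714a, RUN 30 set); rewrites import Pohl13.GaloisSpanGeneric -> HodgeCM.Proofs.Pohlmann.GaloisSpanGeneric x1) (`HOME/pub-hodgecm-pohl-g13/lean/Pohl13/GaloisSpanHyperoctahedral.lean`, md5 ed1a2ecb, 316 lines);
landed by the gen-8 packager in gate run 31 as `HodgeCM/Proofs/Pohlmann/GaloisSpanHyperoctahedral.lean` (import ^import Pohl13\.GaloisSpanGeneric[ \t]*$→import HodgeCM.Proofs.Pohlmann.GaloisSpanGeneric ×1).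
-/
/-
Copyright: pub-hodgecm formalisation cell (harness21, 2026). New file (not vendored).
Origin: HOME/pub-hodgecm-pohl-g13/lean/Pohl13/GaloisSpanHyperoctahedral.lean — session planner-pub-hodgecm-pohl-g13-0 (unit pub-hodgecm-pohl-g13),
EXPANSION part (b) `PohlmannSpan`, generation 13, file 9.  Intended final place: `HodgeCM/Proofs/Pohlmann/GaloisSpanHyperoctahedral.lean`
(module `HodgeCM.Proofs.Pohlmann.GaloisSpanHyperoctahedral`).  ADDITIVE leaf.  WIP import `Pohl13.GaloisSpanGeneric`
= this seat's file 7 (rewrite to `import HodgeCM.Proofs.Pohlmann.GaloisSpanGeneric` on landing).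
-/
import Summits.HodgeConjecture.HodgeCM.Proofs.Pohlmann.GaloisSpanGeneric

/-!
# The hyperoctahedral group of a CM field: `[F̃:ℚ]` DIVIDES `2^g · g!`

`F` a CM field of degree `2g`.  The permutations of `Hom(F, ℂ)` commuting with complex conjugation form a subgroup
`barPerms F ≤ Perm(Hom(F, ℂ))` (`≅ C₂ ≀ S_g`, the hyperoctahedral group); its order is EXACTLY `2^g · g!`
(`NonGalois.card_barPerms`: the code `P ↦ (permutation of the pairs, set of unflipped pairs)` of file 7, extended from
`Gal(F̃/ℚ)` to `barPerms F`, is a bijection onto `Perm(Θ) × (Θ → Bool)` — injective as in file 7, and every code is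
realised by an explicit permutation `permOfCode`).  `Gal(F̃/ℚ)` embeds in it as a group (`NonGalois.galPermHom`,
faithfulness of file 4), so by Lagrange

* **`NonGalois.card_aut_dvd_two_pow_mul_factorial`**, **`NonGalois.finrank_galoisClosure_dvd_two_pow_mul_factorial :
    finrank ℚ (galoisClosure (Fin (0 + 1) → F)) ∣ 2 ^ (finrank ℚ F / 2) * (finrank ℚ F / 2).factorial`**

— sharpening file 7's `≤`.  (With file 8's `[F:ℚ] ∣ [F̃:ℚ]` this pins `[F̃:ℚ]` between `2g` and `2^g·g!` in the
divisibility order; e.g. `∣ 48` for sextic, `∣ 384` for octic CM fields.)  Also: the group of Galois translates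
`GalT F` (tree, `CM/LefschetzChar`) is contained in `barPerms F` (`galTranslates_le_barPerms`).

Nothing is posited; nothing is cited.
-/

noncomputable section

open scoped TensorProduct NumberField BigOperators
open NumberField NumberField.ComplexEmbedding

attribute [local instance] Classical.propDecidable

namespace HodgeCM

open Literature.AlgebraicGeometry.Motives (CMType HodgeStructure)
open HodgeCM.Pohlmann HodgeCM.GaoUllmo HodgeCM.CMTypeOps

namespace NonGalois

/-! ### The hyperoctahedral group `barPerms F` -/

section BarPerms

variable (F : Type) [Field F]

/-- The permutations of `Hom(F, ℂ)` commuting with complex conjugation, as a subgroup of `Perm(Hom(F, ℂ))`. -/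
def barPerms : Subgroup (Equiv.Perm (F →+* ℂ)) where
  carrier := {P | IsBarCommuting P}
  mul_mem' := by
    intro P Q hP hQ s
    show P (Q (conjugate s)) = conjugate (P (Q s))
    rw [hQ, hP]
  one_mem' := fun _ => rfl
  inv_mem' := by
    intro P hP s
    apply P.injective
    show P (P⁻¹ (conjugate s)) = P (conjugate (P⁻¹ s))
    rw [hP, Equiv.Perm.coe_inv, Equiv.apply_symm_apply, Equiv.apply_symm_apply]

variable {F}

/-- (Ported verbatim from the HodgeCMPerL package; no docstring in the source.) -/
theorem mem_barPerms_iff (P : Equiv.Perm (F →+* ℂ)) : P ∈ barPerms F ↔ IsBarCommuting P := Iff.rfl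

/-- Galois translates commute with conjugation (for a CM field `c ∈ Aut(F/ℚ)`). -/
theorem galTranslates_le_barPerms [NumberField F] [IsCMField F] : galTranslates F ≤ barPerms F :=
  fun P hP => isBarCommuting_galT ⟨P, hP⟩

end BarPerms

/-! ### Conjugation-commuting maps with a prescribed code -/

section PermCode

variable {F : Type} [Field F] (Θ : CMType F)

include Θ in
/-- With a CM type around, no embedding is its own conjugate. -/
theorem self_ne_conjugate (x : F →+* ℂ) : x ≠ conjugate x := fun h => by
  by_cases hx : x ∈ Θ.1
  · exact (mem_iff_conjugate_notMem Θ x).mp hx (by rw [← h]; exact hx)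
  · exact hx (by rw [h]; exact (conjugate_mem_iff_notMem Θ x).mpr hx)

/-- The map of pair representatives induced by a conjugation-commuting permutation. -/
def permPairFun (P : barPerms F) (t : ↥Θ.1) : ↥Θ.1 :=
  pairRep Θ (P.1 t)

/-- (Ported verbatim from the HodgeCMPerL package; no docstring in the source.) -/
theorem permPairFun_injective (P : barPerms F) : Function.Injective (permPairFun Θ P) := by
  intro t t' h
  rcases eq_or_eq_conjugate_of_pairRep_eq Θ h with h1 | h1
  · exact Subtype.ext (P.1.injective h1)
  · exfalso
    rw [← P.2 (t' : F →+* ℂ)] at h1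
    have h2 : (t : F →+* ℂ) = conjugate (t' : F →+* ℂ) := P.1.injective h1
    have h3 : conjugate (t' : F →+* ℂ) ∉ Θ.1 := (mem_iff_conjugate_notMem Θ _).mp t'.2
    exact h3 (h2 ▸ t.2)

/-- The value on a representative prescribed by a code `(π, ε)`: `π t`, conjugated iff the pair is flipped (`ε t = false`). -/
def codeVal (c : Equiv.Perm ↥Θ.1 × (↥Θ.1 → Bool)) (t : ↥Θ.1) : F →+* ℂ :=
  if c.2 t then ((c.1 t : ↥Θ.1) : F →+* ℂ) else conjugate ((c.1 t : ↥Θ.1) : F →+* ℂ)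

/-- The self-map of `Hom(F, ℂ)` prescribed by a code. -/
def funOfCode (c : Equiv.Perm ↥Θ.1 × (↥Θ.1 → Bool)) (u : F →+* ℂ) : F →+* ℂ :=
  if hu : u ∈ Θ.1 then codeVal Θ c ⟨u, hu⟩
  else conjugate (codeVal Θ c ⟨conjugate u, (conjugate_mem_iff_notMem Θ u).mpr hu⟩)

/-- (Ported verbatim from the HodgeCMPerL package; no docstring in the source.) -/
theorem funOfCode_of_mem (c : Equiv.Perm ↥Θ.1 × (↥Θ.1 → Bool)) {u : F →+* ℂ} (hu : u ∈ Θ.1) :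
    funOfCode Θ c u = codeVal Θ c ⟨u, hu⟩ := by
  rw [funOfCode, dif_pos hu]

/-- (Ported verbatim from the HodgeCMPerL package; no docstring in the source.) -/
theorem funOfCode_of_not_mem (c : Equiv.Perm ↥Θ.1 × (↥Θ.1 → Bool)) {u : F →+* ℂ} (hu : u ∉ Θ.1) :
    funOfCode Θ c u = conjugate (codeVal Θ c ⟨conjugate u, (conjugate_mem_iff_notMem Θ u).mpr hu⟩) := by
  rw [funOfCode, dif_neg hu]

/-- (Ported verbatim from the HodgeCMPerL package; no docstring in the source.) -/
theorem funOfCode_conjugate_of_mem (c : Equiv.Perm ↥Θ.1 × (↥Θ.1 → Bool)) {u : F →+* ℂ} (hu : u ∈ Θ.1) :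
    funOfCode Θ c (conjugate u) = conjugate (codeVal Θ c ⟨u, hu⟩) := by
  have hu' : conjugate u ∉ Θ.1 := (mem_iff_conjugate_notMem Θ u).mp hu
  rw [funOfCode_of_not_mem Θ c hu',
    show (⟨conjugate (conjugate u), (conjugate_mem_iff_notMem Θ (conjugate u)).mpr hu'⟩ : ↥Θ.1) = ⟨u, hu⟩ from
      Subtype.ext (involutive_conjugate F u)]

/-- `funOfCode` commutes with conjugation. -/
theorem isBarCommuting_funOfCode (c : Equiv.Perm ↥Θ.1 × (↥Θ.1 → Bool)) : IsBarCommuting (funOfCode Θ c) := by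
  intro u
  by_cases hu : u ∈ Θ.1
  · rw [funOfCode_conjugate_of_mem Θ c hu, funOfCode_of_mem Θ c hu]
  · have hu' : conjugate u ∈ Θ.1 := (conjugate_mem_iff_notMem Θ u).mpr hu
    rw [funOfCode_of_mem Θ c hu', funOfCode_of_not_mem Θ c hu, involutive_conjugate]

/-- (Ported verbatim from the HodgeCMPerL package; no docstring in the source.) -/
theorem pairRep_codeVal (c : Equiv.Perm ↥Θ.1 × (↥Θ.1 → Bool)) (t : ↥Θ.1) : pairRep Θ (codeVal Θ c t) = c.1 t := by
  unfold codeVal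
  by_cases h : c.2 t = true
  · rw [if_pos h, pairRep_coe]
  · rw [if_neg h, pairRep_conjugate, pairRep_coe]

/-- (Ported verbatim from the HodgeCMPerL package; no docstring in the source.) -/
theorem pairRep_funOfCode_of_mem (c : Equiv.Perm ↥Θ.1 × (↥Θ.1 → Bool)) {u : F →+* ℂ} (hu : u ∈ Θ.1) :
    pairRep Θ (funOfCode Θ c u) = c.1 ⟨u, hu⟩ := by
  rw [funOfCode_of_mem Θ c hu, pairRep_codeVal]

/-- (Ported verbatim from the HodgeCMPerL package; no docstring in the source.) -/
theorem codeVal_mem_iff (c : Equiv.Perm ↥Θ.1 × (↥Θ.1 → Bool)) (t : ↥Θ.1) : codeVal Θ c t ∈ Θ.1 ↔ c.2 t = true := by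
  unfold codeVal
  by_cases h : c.2 t = true
  · rw [if_pos h]
    exact ⟨fun _ => h, fun _ => (c.1 t).2⟩
  · rw [if_neg h]
    exact ⟨fun hm => absurd hm ((mem_iff_conjugate_notMem Θ _).mp (c.1 t).2), fun h' => absurd h' h⟩

/-- `funOfCode` is injective. -/
theorem funOfCode_injective (c : Equiv.Perm ↥Θ.1 × (↥Θ.1 → Bool)) : Function.Injective (funOfCode Θ c) := by
  -- two elements with the same image, the first in `Θ`, are equal or conjugate …
  have key : ∀ (u v : F →+* ℂ), u ∈ Θ.1 → funOfCode Θ c u = funOfCode Θ c v → u = v ∨ conjugate u = v := by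
    intro u v hu h
    by_cases hv : v ∈ Θ.1
    · have h1 : c.1 ⟨u, hu⟩ = c.1 ⟨v, hv⟩ := by
        rw [← pairRep_funOfCode_of_mem Θ c hu, ← pairRep_funOfCode_of_mem Θ c hv, h]
      exact Or.inl (congrArg Subtype.val (c.1.injective h1))
    · have hv' : conjugate v ∈ Θ.1 := (conjugate_mem_iff_notMem Θ v).mpr hv
      have h2 : funOfCode Θ c (conjugate u) = funOfCode Θ c (conjugate v) := by
        rw [isBarCommuting_funOfCode Θ c u, isBarCommuting_funOfCode Θ c v, h]
      have h1 : c.1 ⟨u, hu⟩ = c.1 ⟨conjugate v, hv'⟩ := by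
        rw [← pairRep_funOfCode_of_mem Θ c hu, ← pairRep_funOfCode_of_mem Θ c hv', ← h2,
          isBarCommuting_funOfCode Θ c u, pairRep_conjugate]
      have h3 : u = conjugate v := congrArg Subtype.val (c.1.injective h1)
      exact Or.inr (by rw [h3, involutive_conjugate])
  -- … and an element and its conjugate have conjugate, hence different, images
  have ne : ∀ u : F →+* ℂ, funOfCode Θ c u ≠ funOfCode Θ c (conjugate u) := by
    intro u h
    rw [isBarCommuting_funOfCode Θ c u] at h
    exact self_ne_conjugate Θ _ h
  intro u v h
  by_cases hu : u ∈ Θ.1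
  · rcases key u v hu h with h1 | h1
    · exact h1
    · exfalso
      rw [← h1] at h
      exact ne u h
  · have hu' : conjugate u ∈ Θ.1 := (conjugate_mem_iff_notMem Θ u).mpr hu
    have h2 : funOfCode Θ c (conjugate u) = funOfCode Θ c (conjugate v) := by
      rw [isBarCommuting_funOfCode Θ c u, isBarCommuting_funOfCode Θ c v, h]
    rcases key (conjugate u) (conjugate v) hu' h2 with h1 | h1
    · exact (involutive_conjugate F).injective h1
    · exfalso
      rw [involutive_conjugate] at h1
      rw [h1] at h
      exact ne v h.symm

/-! ### The code of `P ∈ barPerms F`; every code is realised -/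

variable [NumberField F]

/-- The permutation of pair representatives induced by `P ∈ barPerms F`. -/
def permPairPerm (P : barPerms F) : Equiv.Perm ↥Θ.1 :=
  Equiv.ofBijective (permPairFun Θ P) (Finite.injective_iff_bijective.mp (permPairFun_injective Θ P))

/-- (Ported verbatim from the HodgeCMPerL package; no docstring in the source.) -/
theorem permPairPerm_apply (P : barPerms F) (t : ↥Θ.1) : permPairPerm Θ P t = pairRep Θ (P.1 t) := rfl

/-- The code `(permutation of the pairs, unflipped pairs)` of `P ∈ barPerms F`. -/
def permCode (P : barPerms F) : Equiv.Perm ↥Θ.1 × (↥Θ.1 → Bool) :=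
  (permPairPerm Θ P, fun t => decide (P.1 t ∈ Θ.1))

/-- (Ported verbatim from the HodgeCMPerL package; no docstring in the source.) -/
theorem apply_eq_of_permCode (P : barPerms F) {u : F →+* ℂ} (hu : u ∈ Θ.1) :
    P.1 u = if decide (P.1 u ∈ Θ.1) then ((permPairPerm Θ P ⟨u, hu⟩ : ↥Θ.1) : F →+* ℂ)
      else conjugate ((permPairPerm Θ P ⟨u, hu⟩ : ↥Θ.1) : F →+* ℂ) := by
  rw [permPairPerm_apply]
  by_cases h : P.1 u ∈ Θ.1
  · rw [decide_eq_true h, if_pos rfl, coe_pairRep_of_mem Θ h]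
  · rw [decide_eq_false h, coe_pairRep_of_not_mem Θ h, involutive_conjugate]
    exact (if_neg Bool.false_ne_true).symm

/-- The code is injective on `barPerms F`. -/
theorem permCode_injective : Function.Injective (permCode Θ (F := F)) := by
  intro P Q h
  have hp : permPairPerm Θ P = permPairPerm Θ Q := congrArg Prod.fst h
  have hs : (fun t : ↥Θ.1 => decide (P.1 t ∈ Θ.1)) = fun t : ↥Θ.1 => decide (Q.1 t ∈ Θ.1) := congrArg Prod.snd h
  have hΘ : ∀ (u : F →+* ℂ) (hu : u ∈ Θ.1), P.1 u = Q.1 u := fun u hu => by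
    have hsu := congr_fun hs ⟨u, hu⟩
    simp only at hsu
    rw [apply_eq_of_permCode Θ P hu, apply_eq_of_permCode Θ Q hu, hp, hsu]
  refine Subtype.ext (Equiv.ext fun u => ?_)
  by_cases hu : u ∈ Θ.1
  · exact hΘ u hu
  · have h1 := hΘ (conjugate u) ((conjugate_mem_iff_notMem Θ u).mpr hu)
    rw [P.2 u, Q.2 u] at h1
    exact (involutive_conjugate F).injective h1

/-- The conjugation-commuting PERMUTATION with a prescribed code. -/
def permOfCode (c : Equiv.Perm ↥Θ.1 × (↥Θ.1 → Bool)) : barPerms F :=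
  ⟨Equiv.ofBijective (funOfCode Θ c) (Finite.injective_iff_bijective.mp (funOfCode_injective Θ c)),
    isBarCommuting_funOfCode Θ c⟩

/-- (Ported verbatim from the HodgeCMPerL package; no docstring in the source.) -/
theorem permOfCode_apply (c : Equiv.Perm ↥Θ.1 × (↥Θ.1 → Bool)) (u : F →+* ℂ) : (permOfCode Θ c).1 u = funOfCode Θ c u := rfl

/-- (Ported verbatim from the HodgeCMPerL package; no docstring in the source.) -/
theorem permCode_permOfCode (c : Equiv.Perm ↥Θ.1 × (↥Θ.1 → Bool)) : permCode Θ (permOfCode Θ c) = c := by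
  refine Prod.ext (Equiv.ext fun t => ?_) (funext fun t => ?_)
  · show permPairPerm Θ (permOfCode Θ c) t = c.1 t
    rw [permPairPerm_apply, permOfCode_apply, ← pairRep_funOfCode_of_mem Θ c t.2]
  · show decide ((permOfCode Θ c).1 t ∈ Θ.1) = c.2 t
    rw [permOfCode_apply, funOfCode_of_mem Θ c t.2]
    by_cases h : c.2 t = true
    · rw [h, decide_eq_true ((codeVal_mem_iff Θ c _).mpr h)]
    · rw [Bool.eq_false_iff.mpr h, decide_eq_false (fun hm => h ((codeVal_mem_iff Θ c _).mp hm))]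

/-- The code is a bijection `barPerms F ≃ Perm(Θ) × (Θ → Bool)`. -/
theorem permCode_bijective : Function.Bijective (permCode Θ (F := F)) :=
  ⟨permCode_injective Θ, fun c => ⟨permOfCode Θ c, permCode_permOfCode Θ c⟩⟩

include Θ in
/-- **`|barPerms F| = 2^g · g!`**: the hyperoctahedral group of a number field carrying a CM type `Θ` has order `2^g · g!`
(`g = [F:ℚ]/2`). -/
theorem card_barPerms : Nat.card (barPerms F) = 2 ^ (Module.finrank ℚ F / 2) * (Module.finrank ℚ F / 2).factorial := by
  rw [Nat.card_eq_fintype_card, Fintype.card_of_bijective (permCode_bijective Θ), card_galCode_target]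

end PermCode

/-! ### `Gal(F̃/ℚ) ↪ barPerms F`, hence `[F̃:ℚ] ∣ 2^g · g!` -/

section Galois

variable (F : Type) [Field F] [NumberField F] [IsCMField F]

/-- `σ ↦ (s ↦ σ ∘ s)` as a group homomorphism `Gal(F̃/ℚ) →* barPerms F`. -/
def galPermHom : (galoisClosure (Fin (0 + 1) → F) ≃ₐ[ℚ] galoisClosure (Fin (0 + 1) → F)) →* barPerms F where
  toFun σ := ⟨(galTOf σ).1, isBarCommuting_galF σ⟩
  map_one' := Subtype.ext (Equiv.ext fun s => galF_one (n := 0) s)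
  map_mul' σ τ := Subtype.ext (Equiv.ext fun s => galF_mul σ τ s)

/-- (Ported verbatim from the HodgeCMPerL package; no docstring in the source.) -/
theorem galPermHom_apply (σ : galoisClosure (Fin (0 + 1) → F) ≃ₐ[ℚ] galoisClosure (Fin (0 + 1) → F)) (s : F →+* ℂ) :
    (galPermHom F σ).1 s = galF 0 σ s := rfl

/-- The embedding is injective (faithfulness, file 4). -/
theorem galPermHom_injective : Function.Injective (galPermHom F) := by
  intro σ τ h
  exact eq_of_galF_eq (funext fun s => by rw [← galPermHom_apply, ← galPermHom_apply, h])

/-- **`|Gal(F̃/ℚ)| ∣ 2^g · g!`.** -/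
theorem card_aut_dvd_two_pow_mul_factorial :
    Nat.card (galoisClosure (Fin (0 + 1) → F) ≃ₐ[ℚ] galoisClosure (Fin (0 + 1) → F)) ∣
      2 ^ (Module.finrank ℚ F / 2) * (Module.finrank ℚ F / 2).factorial := by
  rw [← card_barPerms (placesType F)]
  exact Subgroup.card_dvd_of_injective (galPermHom F) (galPermHom_injective F)

/-- **THEOREM. `[F̃:ℚ]` divides `2^g · g!`** for a CM field `F` of degree `2g` (`F̃` = the Galois closure of `F` in `ℂ`):
`Gal(F̃/ℚ)` is a subgroup of the hyperoctahedral group `C₂ ≀ S_g`. -/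
theorem finrank_galoisClosure_dvd_two_pow_mul_factorial :
    Module.finrank ℚ (galoisClosure (Fin (0 + 1) → F)) ∣ 2 ^ (Module.finrank ℚ F / 2) * (Module.finrank ℚ F / 2).factorial := by
  rw [← IsGalois.card_aut_eq_finrank]
  exact card_aut_dvd_two_pow_mul_factorial F

/-- Sextic CM fields: `[F̃:ℚ] ∣ 48`. -/
theorem finrank_galoisClosure_dvd_48 (h6 : Module.finrank ℚ F = 6) :
    Module.finrank ℚ (galoisClosure (Fin (0 + 1) → F)) ∣ 48 := by
  have h := finrank_galoisClosure_dvd_two_pow_mul_factorial F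
  rw [h6] at h
  exact h

/-- Octic CM fields: `[F̃:ℚ] ∣ 384`. -/
theorem finrank_galoisClosure_dvd_384 (h8 : Module.finrank ℚ F = 8) :
    Module.finrank ℚ (galoisClosure (Fin (0 + 1) → F)) ∣ 384 := by
  have h := finrank_galoisClosure_dvd_two_pow_mul_factorial F
  rw [h8] at h
  exact h

/-- The group of Galois translates `GalT F` has order dividing `2^g · g!` too. -/
theorem card_galT_dvd_two_pow_mul_factorial :
    Nat.card (GalT F) ∣ 2 ^ (Module.finrank ℚ F / 2) * (Module.finrank ℚ F / 2).factorial := by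
  rw [← card_barPerms (placesType F)]
  exact Subgroup.card_dvd_of_le galTranslates_le_barPerms

end Galois

end NonGalois

end HodgeCM
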